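/-
Copyright (c) 2026 the pub-hodgecm-mathlib formalisation cell (harness21).  Prover seat hodgecm-mathlib-F0P2-p01 (g13), 2026-09-01.  Road «S3-tree», hand «T4′-GEN»
(architect A-p16 (g29) A-68 (b)): THE CLASS-REFINED LEVEL SHIFT — on the interior fixed vertices the classes of `γ` modulo `c^{j+1}` are the classes of the shifted ∕ Cayley element
`u` modulo `c^j`, relabelled by ONE fixed polynomial `r = 1 + c·(q − 1)`.
-/
import Literature.NumberTheory.Automorphic.UnitaryLatticeTreeOrderStability   -- ★ p845548 (this seat): ORDER-STABILITY over ★ C1 `UnitaryLatticeTreeLevelShift` p845386; ⊇ ★ T1a∕T1b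
import Literature.NumberTheory.Automorphic.UnitaryLatticeTreeStabilizer       -- ★ (F0P2-p02 (g10)): `mapGL_latt_eq_latt_iff` (the stabiliser test `g⁻¹γg ∈ GL_N(𝒪)`)
import Literature.NumberTheory.Automorphic.UnitaryLatticeTreeResiduallyUnipotentCorner   -- ★ p845859: `isIntMatrix_pow`; brings ★ `…TypeTwoGram` (B-p14 (g35)) `isIntMatrix_mul` — both cited BY NAME (dedup)
import Mathlib.RingTheory.Adjoin.Polynomial.Basic
import HarnessLib

/-!
# The lattice graph of a hermitian space — THE CLASS-REFINED LEVEL SHIFT «T4′-GEN» (road «S3-tree», architect A-68 (b); Kottwitz 1986 §3, Rogawski 1990 §4.9)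

Topic `NumberTheory/Automorphic`; namespace `Literature.NumberTheory.Automorphic.UnitaryLatticeTree` (T1a currency: `[Valued K ℤᵐ⁰]`, `latt`, `mapGL`, `IsIntMatrix`,
`IsVertexLattice σ ϖ H d`).  THEOREMS ONLY (no definition, no instance, no notation, no named fact, no `sorry`); any `N`, any valued field; zero `U(2,1)`-specific content.
Cell `pub/hodgecm-mathlib` (D-0151), crux H413 = `stmt-HodgeConjecture-24833`; road «S3-tree» (LEAD F0P3a-plan (g11), architect A-p16 (g29) A-68 (b) «HOLDER WANTED for the
class-refined shift head T4′-GEN»; T3′∕CAYLEY F0P3b-p01 (g11) supplies the unit `u` — the Cayley transform of the shifted element — with `𝒪[γ^{(c)}] = 𝒪[u]`).  Seat F0P2-p01 (g13).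
HONEST LABEL: HC_CM is proved only modulo the 2 remaining named inputs (hLiu418 24832, h413 24833) until rung 0 closes; nothing printed is asserted here — this is matrix
algebra over a valuation ring; S3 stays a print row until the road's END lands.

THE MATHEMATICS.  Fix `0 < |c| < 1` (think `c = ϖ`), `γ ∈ GL_N(K)`, its shift `X := γ^{(c)} = 1 + c⁻¹(γ − 1)`, and a unit `u` with `X = q(u)` for a polynomial `q ∈ 𝒪[T]`
(T3′'s Cayley element: `𝒪[X] = 𝒪[u]`).  Put `r := 1 + c·(q − 1) ∈ 𝒪[T]`.  Then
* `γ = r(u)` (§2 `aeval_relabel_eq`), and conjugation commutes with `r`: `g⁻¹γg = r(g⁻¹ug)` (§1 `aeval_units_conj`, §4);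
* polynomial maps preserve integrality and congruences: `A ≡ B (mod c^j)` (i.e. `(c^j)⁻¹(A − B)` integral, `A, B` integral) ⇒ `q(A) ≡ q(B) (mod c^j)` (§3), and `r` GAINS A
  LEVEL: `A ≡ B (mod c^j) ⇒ r(A) ≡ r(B) (mod c^{j+1})` (§3 `isIntMatrix_inv_pow_succ_smul_aeval_relabel_sub`);
* hence (§4–§5): on every `u`-fixed lattice `latt g` (= every INTERIOR level-`c` fixed vertex of `γ`, ★ C1 + ★ ORDER-STABILITY: `{γ·M = M ∧ (γ−1)·M ⊆ c·M} = {u·M = M}`)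
  the integral matrix `g⁻¹γg` is `r(g⁻¹ug)` with `g⁻¹ug` integral, and every level-`c^{j+1}` class datum `Ψ` of `γ` (a function of integral matrices constant on
  `c^{j+1}`-congruence classes, e.g. a `K(j+1)`-invariant class function read in a basis of the vertex) is the level-`c^j` class datum `Ψ ∘ r` of `u`:
  `Ψ(g⁻¹γg) = (Ψ ∘ r)(g⁻¹ug)`, with `Ψ ∘ r` again conjugation-invariant when `Ψ` is.  This is the induction step `(γ, level j+1) ↦ (u, level j)` of the T4′ row
  (depth and all root valuations drop by one: CAYLEY §4), the «classes relabelled by a fixed polynomial» clause of A-68 (b).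

* §1 `units_inv_mul_pow_mul`, `aeval_units_conj` — `(g⁻¹Ag)^n = g⁻¹A^ng`, `aeval (g⁻¹Ag) q = g⁻¹ (aeval A q) g`.
* §2 `aeval_relabel`, `aeval_relabel_eq`, `mem_adjoin_singleton_of_aeval_eq`, `exists_aeval_eq_of_mem_adjoin_singleton`, `adjoin_singleton_one_add_eq`,
  `one_add_mem_adjoin_singleton` — `r(A) = 1 + c(q(A) − 1)`; `q(u) = γ^{(c)} ⇒ r(u) = γ`; `aeval`-form ⇔ `adjoin`-membership; `𝒪[1 + X] = 𝒪[X]`.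
* §3 `isIntMatrix_add∕sub∕smul_of_v_le_one∕one∕zero∕sum∕aeval` (+ ★ `isIntMatrix_mul`, ★ `isIntMatrix_pow` by name), `isIntMatrix_inv_smul_pow_sub_pow`, `isIntMatrix_inv_smul_aeval_sub_aeval`,
  `isIntMatrix_inv_pow_succ_smul_aeval_relabel_sub`, `isIntMatrix_inv_pow_smul_aeval_sub_of_relabel`, `isIntMatrix_relabel_sub_iff` — integrality and congruences under
  polynomial maps; the level gain of `r`; with an inverse polynomial `p` the relabelling is a BIJECTION on congruence classes (`mod c^{j+1}` ↔ `mod c^j`).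
* §4 `isIntMatrix_units_conj_of_mapGL_latt_eq`, `units_conj_eq_aeval_relabel_of_mapGL_latt_eq` — on a `u`-fixed lattice: `g⁻¹ug` integral and `g⁻¹γg = r(g⁻¹ug)`.
* §5 `levelClass_relabel`, `levelClass_relabel_conjInvariant`, `levelClass_of_leftInvariant`, `apply_units_conj_eq_of_aeval_eq` — transport of level-class data `Ψ ↦ Ψ ∘ r`
  inside a carrier set `T` (level `j+1 ↦ j`, conjugation-invariance kept, values on fixed vertices equal); the adapter «left-invariance under `U ≡ 1 (c^j)` ⇒ constancy
  on `c^j`-classes» (A-69 (β), matrix side).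
* §6 `finsum_mem_levelFixed_vertex_eq_finsum_mem_fixed` — the count form: `∑ᶠ` over the interior level-`c` fixed vertices of `γ` = `∑ᶠ` over the `u`-fixed vertices.

## References
* [Kottwitz1986] R. E. Kottwitz, *Base change for unit elements of Hecke algebras*, Compositio Math. 60 (1986): §3.
* [Rogawski1990] J. Rogawski, Ann. of Math. Stud. 123 (1990): §4.9 Prop. 4.9.1 (a) p. 55 (germ expansion by depth).
* [Laumon1995] G. Laumon, *Cohomology of Drinfeld Modular Varieties* I (1996): Lemma (5.3.2) p. 136.
* [Serre1980Trees] J.-P. Serre, *Trees* (1980): Ch. II §1.1–1.2.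
-/

set_option autoImplicit false

noncomputable section

open scoped Valued WithZero Matrix MatrixGroups Polynomial

namespace Literature.NumberTheory.Automorphic.UnitaryLatticeTree

open Literature.NumberTheory.Automorphic Literature.NumberTheory.Automorphic.HermitianLattice Polynomial

variable {K : Type*} [Field K] [Valued K ℤᵐ⁰] {N : ℕ}

/-! ## §1 Conjugation commutes with polynomial maps -/

omit [Valued K ℤᵐ⁰] in
/-- `(g⁻¹ A g)^n = g⁻¹ A^n g`. [cite: Serre1980Trees, Ch. II §1.1] -/
theorem units_inv_mul_pow_mul (g : GL (Fin N) K) (A : Matrix (Fin N) (Fin N) K) (n : ℕ) :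
    (((g⁻¹ : GL (Fin N) K) : Matrix (Fin N) (Fin N) K) * A * (g : Matrix (Fin N) (Fin N) K)) ^ n =
      ((g⁻¹ : GL (Fin N) K) : Matrix (Fin N) (Fin N) K) * A ^ n * (g : Matrix (Fin N) (Fin N) K) := by
  have hg : (g : Matrix (Fin N) (Fin N) K) * ((g⁻¹ : GL (Fin N) K) : Matrix (Fin N) (Fin N) K) = 1 := by
    rw [← Units.val_mul, mul_inv_cancel, Units.val_one]
  induction n with
  | zero => rw [pow_zero, pow_zero, Matrix.mul_one, ← Units.val_mul, inv_mul_cancel, Units.val_one]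
  | succ n ih =>
      rw [pow_succ, ih, pow_succ]
      simp only [Matrix.mul_assoc]
      rw [← Matrix.mul_assoc (g : Matrix (Fin N) (Fin N) K) ((g⁻¹ : GL (Fin N) K) : Matrix (Fin N) (Fin N) K), hg, Matrix.one_mul]

/-- **`aeval (g⁻¹ A g) q = g⁻¹ (aeval A q) g`** for `q ∈ 𝒪[T]`: the class of `q(A)` is a function of the class of `A`. [cite: Kottwitz1986, §3] -/
theorem aeval_units_conj (g : GL (Fin N) K) (A : Matrix (Fin N) (Fin N) K) (q : 𝒪[K][X]) :
    aeval (((g⁻¹ : GL (Fin N) K) : Matrix (Fin N) (Fin N) K) * A * (g : Matrix (Fin N) (Fin N) K)) q =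
      ((g⁻¹ : GL (Fin N) K) : Matrix (Fin N) (Fin N) K) * aeval A q * (g : Matrix (Fin N) (Fin N) K) := by
  induction q using Polynomial.induction_on' with
  | add p q hp hq => rw [map_add, map_add, hp, hq, Matrix.mul_add, Matrix.add_mul]
  | monomial n a =>
      rw [aeval_monomial, aeval_monomial, units_inv_mul_pow_mul, Algebra.algebraMap_eq_smul_one, smul_mul_assoc, one_mul, smul_mul_assoc, one_mul,
        Matrix.mul_smul, Matrix.smul_mul]

/-! ## §2 The relabelling polynomial `r = 1 + c·(q − 1)` -/

/-- `aeval A (1 + C c·(q − 1)) = 1 + c • (aeval A q − 1)`. [cite: Kottwitz1986, §3] -/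
theorem aeval_relabel (A : Matrix (Fin N) (Fin N) K) (c : 𝒪[K]) (q : 𝒪[K][X]) :
    aeval A (1 + C c * (q - 1)) = 1 + (c : K) • (aeval A q - 1) := by
  rw [map_add, map_one, map_mul, aeval_C, map_sub, map_one, Algebra.algebraMap_eq_smul_one, smul_mul_assoc, one_mul]
  rfl

/-- **`γ = r(u)`**: if `q(u) = γ^{(c)} = 1 + c⁻¹(γ − 1)` then `(1 + c·(q − 1))(u) = γ`. [cite: Kottwitz1986, §3] [cite: Laumon1995, Lemma (5.3.2) p. 136] -/
theorem aeval_relabel_eq {c : 𝒪[K]} (hc : (c : K) ≠ 0) (u γ : Matrix (Fin N) (Fin N) K) (q : 𝒪[K][X])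
    (hq : aeval u q = 1 + (c : K)⁻¹ • (γ - 1)) : aeval u (1 + C c * (q - 1)) = γ := by
  rw [aeval_relabel, hq, add_sub_cancel_left, smul_smul, mul_inv_cancel₀ hc, one_smul, add_sub_cancel]

omit [Valued K ℤᵐ⁰] in
/-- `aeval`-form ⇒ `adjoin`-membership: `aeval x q = y ⇒ y ∈ Algebra.adjoin R {x}` (the shape ★ ORDER-STABILITY consumes). [cite: Kottwitz1986, §3] -/
theorem mem_adjoin_singleton_of_aeval_eq {R : Type*} [CommRing R] [Algebra R K] (x y : Matrix (Fin N) (Fin N) K) (q : R[X]) (h : aeval x q = y) :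
    y ∈ Algebra.adjoin R ({x} : Set (Matrix (Fin N) (Fin N) K)) := by
  rw [Algebra.adjoin_singleton_eq_range_aeval]
  exact ⟨q, h⟩

omit [Valued K ℤᵐ⁰] in
/-- `adjoin`-membership ⇒ `aeval`-form: `y ∈ Algebra.adjoin R {x} ⇒ ∃ q, aeval x q = y` (the shape ★ CAYLEY `conj_diagonal_mem_adjoin_of_mem_span_pow` emits ⇒ the
polynomial witness the heads below consume). [cite: Kottwitz1986, §3] -/
theorem exists_aeval_eq_of_mem_adjoin_singleton {R : Type*} [CommRing R] [Algebra R K] {x y : Matrix (Fin N) (Fin N) K}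
    (h : y ∈ Algebra.adjoin R ({x} : Set (Matrix (Fin N) (Fin N) K))) : ∃ q : R[X], aeval x q = y := by
  rwa [Algebra.adjoin_singleton_eq_range_aeval] at h

omit [Valued K ℤᵐ⁰] in
/-- **`𝒪[1 + X] = 𝒪[X]`**: the shift `γ^{(c)} = 1 + c⁻¹(γ − 1)` and `c⁻¹(γ − 1)` generate the same order (CAYLEY speaks `c⁻¹ • (τ − 1)`, ★ C1 speaks `1 + c⁻¹ • (↑γ − 1)`).
[cite: Kottwitz1986, §3] [cite: Laumon1995, Lemma (5.3.2) p. 136] -/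
theorem adjoin_singleton_one_add_eq {R : Type*} [CommRing R] [Algebra R K] (x : Matrix (Fin N) (Fin N) K) :
    Algebra.adjoin R ({1 + x} : Set (Matrix (Fin N) (Fin N) K)) = Algebra.adjoin R ({x} : Set (Matrix (Fin N) (Fin N) K)) := by
  apply le_antisymm
  · rw [Algebra.adjoin_le_iff, Set.singleton_subset_iff]
    exact add_mem (Subalgebra.one_mem _) (Algebra.self_mem_adjoin_singleton R x)
  · rw [Algebra.adjoin_le_iff, Set.singleton_subset_iff, SetLike.mem_coe]
    have h1 : (1 + x) - 1 ∈ Algebra.adjoin R ({1 + x} : Set (Matrix (Fin N) (Fin N) K)) :=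
      sub_mem (Algebra.self_mem_adjoin_singleton R (1 + x)) (Subalgebra.one_mem _)
    rwa [add_sub_cancel_left] at h1

omit [Valued K ℤᵐ⁰] in
/-- `x ∈ 𝒪[y] ⇒ 1 + x ∈ 𝒪[y]`. [cite: Kottwitz1986, §3] -/
theorem one_add_mem_adjoin_singleton {R : Type*} [CommRing R] [Algebra R K] {x y : Matrix (Fin N) (Fin N) K}
    (h : x ∈ Algebra.adjoin R ({y} : Set (Matrix (Fin N) (Fin N) K))) : 1 + x ∈ Algebra.adjoin R ({y} : Set (Matrix (Fin N) (Fin N) K)) :=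
  add_mem (Subalgebra.one_mem _) h

/-! ## §3 Integrality and congruences under polynomial maps -/

/-- Sum of integral matrices is integral. [cite: Serre1980Trees, Ch. II §1.1] -/
theorem isIntMatrix_add {A B : Matrix (Fin N) (Fin N) K} (hA : IsIntMatrix A) (hB : IsIntMatrix B) : IsIntMatrix (A + B) := fun i j => by
  rw [Matrix.add_apply]
  exact (Valued.v.map_add_le (hA i j) (hB i j))

/-- Difference of integral matrices is integral. [cite: Serre1980Trees, Ch. II §1.1] -/
theorem isIntMatrix_sub {A B : Matrix (Fin N) (Fin N) K} (hA : IsIntMatrix A) (hB : IsIntMatrix B) : IsIntMatrix (A - B) := fun i j => by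
  rw [Matrix.sub_apply]
  exact (Valued.v.map_sub_le (hA i j) (hB i j))

/-- An integral scalar multiple of an integral matrix is integral. [cite: Serre1980Trees, Ch. II §1.1] -/
theorem isIntMatrix_smul_of_v_le_one {a : K} (ha : Valued.v a ≤ 1) {A : Matrix (Fin N) (Fin N) K} (hA : IsIntMatrix A) : IsIntMatrix (a • A) := fun i j => by
  rw [Matrix.smul_apply, smul_eq_mul, map_mul]
  exact mul_le_one' ha (hA i j)

/-- `1` is integral. [cite: Serre1980Trees, Ch. II §1.1] -/
theorem isIntMatrix_one : IsIntMatrix (1 : Matrix (Fin N) (Fin N) K) := fun i j => by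
  rw [Matrix.one_apply]
  split_ifs
  · rw [map_one]
  · rw [map_zero]; exact zero_le_one

/-- `0` is integral. [cite: Serre1980Trees, Ch. II §1.1] -/
theorem isIntMatrix_zero : IsIntMatrix (0 : Matrix (Fin N) (Fin N) K) := fun i j => by
  rw [Matrix.zero_apply, map_zero]; exact zero_le_one

/-- Finite sums of integral matrices are integral. [cite: Serre1980Trees, Ch. II §1.1] -/
theorem isIntMatrix_sum {ι : Type*} (s : Finset ι) {f : ι → Matrix (Fin N) (Fin N) K} (hf : ∀ i ∈ s, IsIntMatrix (f i)) : IsIntMatrix (∑ i ∈ s, f i) :=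
  Finset.sum_induction f IsIntMatrix (fun _ _ => isIntMatrix_add) isIntMatrix_zero hf

/-- **`q(A)` is integral for `A` integral and `q ∈ 𝒪[T]`.** [cite: Kottwitz1986, §3] -/
theorem isIntMatrix_aeval {A : Matrix (Fin N) (Fin N) K} (hA : IsIntMatrix A) (q : 𝒪[K][X]) : IsIntMatrix (aeval A q) := by
  rw [aeval_eq_sum_range]
  refine isIntMatrix_sum _ fun i _ => ?_
  have e : q.coeff i • A ^ i = ((q.coeff i : 𝒪[K]) : K) • A ^ i := rfl
  rw [e]
  exact isIntMatrix_smul_of_v_le_one (q.coeff i).2 (isIntMatrix_pow hA i)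

/-- **congruences pass to powers**: `A, B` integral, `d⁻¹(A − B)` integral ⇒ `d⁻¹(A^n − B^n)` integral (`A^{n+1} − B^{n+1} = A(A^n − B^n) + (A − B)B^n`).
[cite: Kottwitz1986, §3] -/
theorem isIntMatrix_inv_smul_pow_sub_pow {A B : Matrix (Fin N) (Fin N) K} (hA : IsIntMatrix A) (hB : IsIntMatrix B) (d : K)
    (hAB : IsIntMatrix (d⁻¹ • (A - B))) (n : ℕ) : IsIntMatrix (d⁻¹ • (A ^ n - B ^ n)) := by
  induction n with
  | zero => rw [pow_zero, pow_zero, sub_self, smul_zero]; exact isIntMatrix_zero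
  | succ n ih =>
      have e : d⁻¹ • (A ^ (n + 1) - B ^ (n + 1)) = A * (d⁻¹ • (A ^ n - B ^ n)) + d⁻¹ • (A - B) * B ^ n := by
        rw [Matrix.mul_smul, Matrix.smul_mul, ← smul_add, Matrix.mul_sub, Matrix.sub_mul, pow_succ', pow_succ']
        congr 1
        abel
      rw [e]
      exact isIntMatrix_add (isIntMatrix_mul hA ih) (isIntMatrix_mul hAB (isIntMatrix_pow hB n))

/-- **congruences pass to polynomial maps**: `A ≡ B (mod d)` ⇒ `q(A) ≡ q(B) (mod d)` for `q ∈ 𝒪[T]`. [cite: Kottwitz1986, §3] -/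
theorem isIntMatrix_inv_smul_aeval_sub_aeval {A B : Matrix (Fin N) (Fin N) K} (hA : IsIntMatrix A) (hB : IsIntMatrix B) (d : K)
    (hAB : IsIntMatrix (d⁻¹ • (A - B))) (q : 𝒪[K][X]) : IsIntMatrix (d⁻¹ • (aeval A q - aeval B q)) := by
  rw [aeval_eq_sum_range, aeval_eq_sum_range' (lt_add_one _), ← Finset.sum_sub_distrib, Finset.smul_sum]
  refine isIntMatrix_sum _ fun i _ => ?_
  have e : d⁻¹ • (q.coeff i • A ^ i - q.coeff i • B ^ i) = ((q.coeff i : 𝒪[K]) : K) • (d⁻¹ • (A ^ i - B ^ i)) := by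
    rw [← smul_sub, show q.coeff i • (A ^ i - B ^ i) = ((q.coeff i : 𝒪[K]) : K) • (A ^ i - B ^ i) from rfl, smul_smul, smul_smul, mul_comm]
  rw [e]
  exact isIntMatrix_smul_of_v_le_one (q.coeff i).2 (isIntMatrix_inv_smul_pow_sub_pow hA hB d hAB i)

/-- **THE LEVEL GAIN of `r = 1 + c·(q − 1)`**: `A ≡ B (mod c^j)` ⇒ `r(A) ≡ r(B) (mod c^{j+1})` (`r(A) − r(B) = c·(q(A) − q(B))`). [cite: Kottwitz1986, §3]
[cite: Rogawski1990, §4.9 Prop. 4.9.1 (a) p. 55] -/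
theorem isIntMatrix_inv_pow_succ_smul_aeval_relabel_sub {A B : Matrix (Fin N) (Fin N) K} (hA : IsIntMatrix A) (hB : IsIntMatrix B) {c : 𝒪[K]} (hc : (c : K) ≠ 0)
    (j : ℕ) (hAB : IsIntMatrix (((c : K) ^ j)⁻¹ • (A - B))) (q : 𝒪[K][X]) :
    IsIntMatrix (((c : K) ^ (j + 1))⁻¹ • (aeval A (1 + C c * (q - 1)) - aeval B (1 + C c * (q - 1)))) := by
  have e : ((c : K) ^ (j + 1))⁻¹ • (aeval A (1 + C c * (q - 1)) - aeval B (1 + C c * (q - 1))) = ((c : K) ^ j)⁻¹ • (aeval A q - aeval B q) := by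
    rw [aeval_relabel, aeval_relabel, add_sub_add_left_eq_sub, ← smul_sub, sub_sub_sub_cancel_right, smul_smul, pow_succ, mul_inv,
      inv_mul_cancel_right₀ hc]
  rw [e]
  exact isIntMatrix_inv_smul_aeval_sub_aeval hA hB _ hAB q

/-- Converse of the level gain: `r(A) ≡ r(B) (mod c^{j+1}) ⇒ q(A) ≡ q(B) (mod c^j)`. [cite: Kottwitz1986, §3] -/
theorem isIntMatrix_inv_pow_smul_aeval_sub_of_relabel (A B : Matrix (Fin N) (Fin N) K) {c : 𝒪[K]} (hc : (c : K) ≠ 0) (j : ℕ) (q : 𝒪[K][X])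
    (h : IsIntMatrix (((c : K) ^ (j + 1))⁻¹ • (aeval A (1 + C c * (q - 1)) - aeval B (1 + C c * (q - 1))))) :
    IsIntMatrix (((c : K) ^ j)⁻¹ • (aeval A q - aeval B q)) := by
  have e : ((c : K) ^ (j + 1))⁻¹ • (aeval A (1 + C c * (q - 1)) - aeval B (1 + C c * (q - 1))) = ((c : K) ^ j)⁻¹ • (aeval A q - aeval B q) := by
    rw [aeval_relabel, aeval_relabel, add_sub_add_left_eq_sub, ← smul_sub, sub_sub_sub_cancel_right, smul_smul, pow_succ, mul_inv,
      inv_mul_cancel_right₀ hc]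
  rwa [e] at h

/-- **THE RELABELLING IS A BIJECTION ON CLASSES** (where `q` is inverted by `p`, as for the Cayley pair `u = p(X)`, `X = q(u)` and all their conjugates): for integral `A, B` with
`p(q(A)) = A`, `p(q(B)) = B`: `r(A) ≡ r(B) (mod c^{j+1}) ↔ A ≡ B (mod c^j)` — «class of `γ̄` mod `𝔭^{j+1}` ↔ class of `ū` mod `𝔭^j`» (A-68 (b)). [cite: Kottwitz1986, §3]
[cite: Rogawski1990, §4.9 Prop. 4.9.1 (a) p. 55] -/
theorem isIntMatrix_relabel_sub_iff {A B : Matrix (Fin N) (Fin N) K} (hA : IsIntMatrix A) (hB : IsIntMatrix B) {c : 𝒪[K]} (hc : (c : K) ≠ 0) (j : ℕ)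
    (q p : 𝒪[K][X]) (hpA : aeval (aeval A q) p = A) (hpB : aeval (aeval B q) p = B) :
    IsIntMatrix (((c : K) ^ (j + 1))⁻¹ • (aeval A (1 + C c * (q - 1)) - aeval B (1 + C c * (q - 1)))) ↔ IsIntMatrix (((c : K) ^ j)⁻¹ • (A - B)) := by
  refine ⟨fun h => ?_, fun h => isIntMatrix_inv_pow_succ_smul_aeval_relabel_sub hA hB hc j h q⟩
  have h1 := isIntMatrix_inv_smul_aeval_sub_aeval (isIntMatrix_aeval hA q) (isIntMatrix_aeval hB q) _
    (isIntMatrix_inv_pow_smul_aeval_sub_of_relabel A B hc j q h) p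
  rwa [hpA, hpB] at h1

/-! ## §4 On a `u`-fixed lattice: the matrix of `γ` is `r` of the (integral) matrix of `u` -/

/-- On a `u`-fixed lattice `latt g` the matrix `g⁻¹ug` is integral (★ stabiliser test). [cite: Serre1980Trees, Ch. II §1.1] -/
theorem isIntMatrix_units_conj_of_mapGL_latt_eq (u g : GL (Fin N) K) (h : mapGL u (latt (g : Matrix (Fin N) (Fin N) K)) = latt (g : Matrix (Fin N) (Fin N) K)) :
    IsIntMatrix (((g⁻¹ * u * g : GL (Fin N) K)) : Matrix (Fin N) (Fin N) K) :=
  ((mapGL_latt_eq_latt_iff u g).1 h).1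

/-- **`g⁻¹γg = r(g⁻¹ug)`** whenever `q(u) = γ^{(c)}`: the matrix of `γ` in ANY basis is the relabelling polynomial applied to the matrix of `u` in that basis.
[cite: Kottwitz1986, §3] [cite: Laumon1995, Lemma (5.3.2) p. 136] -/
theorem units_conj_eq_aeval_relabel {c : 𝒪[K]} (hc : (c : K) ≠ 0) (γ u g : GL (Fin N) K) (q : 𝒪[K][X])
    (hq : aeval (u : Matrix (Fin N) (Fin N) K) q = 1 + (c : K)⁻¹ • ((γ : Matrix (Fin N) (Fin N) K) - 1)) :
    ((g⁻¹ * γ * g : GL (Fin N) K) : Matrix (Fin N) (Fin N) K) = aeval ((g⁻¹ * u * g : GL (Fin N) K) : Matrix (Fin N) (Fin N) K) (1 + C c * (q - 1)) := by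
  rw [Units.val_mul, Units.val_mul, Units.val_mul, Units.val_mul, aeval_units_conj, aeval_relabel_eq hc _ _ q hq]

/-! ## §5 Transport of level-class data: `Ψ ↦ Ψ ∘ r` lowers the level by one and keeps conjugation-invariance -/

/-- **LEVEL TRANSPORT**: if `Ψ` is constant on `c^{j+1}`-congruence classes of integral matrices inside a set `T` (the matrices where the class datum lives, e.g. the
`GL_N(𝒪)`-points of `g⁻¹·U(H)·g`; `T = univ` allowed), then `Ψ ∘ r` is constant on `c^j`-congruence classes of integral matrices whose `r`-images lie in `T`.
[cite: Kottwitz1986, §3] [cite: Rogawski1990, §4.9 Prop. 4.9.1 (a) p. 55] -/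
theorem levelClass_relabel {β : Type*} (Ψ : Matrix (Fin N) (Fin N) K → β) (T : Set (Matrix (Fin N) (Fin N) K)) {c : 𝒪[K]} (hc : (c : K) ≠ 0) (j : ℕ) (q : 𝒪[K][X])
    (hΨ : ∀ A ∈ T, ∀ B ∈ T, IsIntMatrix A → IsIntMatrix B → IsIntMatrix (((c : K) ^ (j + 1))⁻¹ • (A - B)) → Ψ A = Ψ B)
    (A B : Matrix (Fin N) (Fin N) K) (hA : IsIntMatrix A) (hB : IsIntMatrix B) (hrA : aeval A (1 + C c * (q - 1)) ∈ T) (hrB : aeval B (1 + C c * (q - 1)) ∈ T)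
    (hAB : IsIntMatrix (((c : K) ^ j)⁻¹ • (A - B))) :
    Ψ (aeval A (1 + C c * (q - 1))) = Ψ (aeval B (1 + C c * (q - 1))) :=
  hΨ _ hrA _ hrB (isIntMatrix_aeval hA _) (isIntMatrix_aeval hB _) (isIntMatrix_inv_pow_succ_smul_aeval_relabel_sub hA hB hc j hAB q)

/-- **CONJUGATION-INVARIANCE TRANSPORT**: if `Ψ(k⁻¹Ak) = Ψ(A)` for all `k ∈ S` and `A ∈ T`, then `(Ψ ∘ r)(k⁻¹Ak) = (Ψ ∘ r)(A)` whenever `r(A) ∈ T` (`r(k⁻¹Ak) = k⁻¹r(A)k`).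
[cite: Kottwitz1986, §3] -/
theorem levelClass_relabel_conjInvariant {β : Type*} (Ψ : Matrix (Fin N) (Fin N) K → β) (T : Set (Matrix (Fin N) (Fin N) K)) (c : 𝒪[K]) (q : 𝒪[K][X])
    (S : Set (GL (Fin N) K))
    (hΨ : ∀ k ∈ S, ∀ A ∈ T, Ψ (((k⁻¹ : GL (Fin N) K) : Matrix (Fin N) (Fin N) K) * A * (k : Matrix (Fin N) (Fin N) K)) = Ψ A)
    (k : GL (Fin N) K) (hk : k ∈ S) (A : Matrix (Fin N) (Fin N) K) (hrA : aeval A (1 + C c * (q - 1)) ∈ T) :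
    Ψ (aeval (((k⁻¹ : GL (Fin N) K) : Matrix (Fin N) (Fin N) K) * A * (k : Matrix (Fin N) (Fin N) K)) (1 + C c * (q - 1))) = Ψ (aeval A (1 + C c * (q - 1))) := by
  rw [aeval_units_conj, hΨ k hk _ hrA]

/-- **ADAPTER «left-invariance ⇒ class constancy»** (the seam to A-69 (β), matrix side, choice-free): if `Ψ(U·A) = Ψ(A)` whenever `A, U·A ∈ T` and `U` is integral with
`U ≡ 1 (mod d)`, then `Ψ(A) = Ψ(B)` for `A, B ∈ T` with `A⁻¹`, `B` integral and `B ≡ A (mod d)` (`B = (BA⁻¹)·A`, `BA⁻¹ − 1 = (B − A)A⁻¹ ≡ 0`; `d = c^j` in use, any `d` here).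
[cite: Kottwitz1986, §3] -/
theorem levelClass_of_leftInvariant {β : Type*} (Ψ : Matrix (Fin N) (Fin N) K → β) (T : Set (Matrix (Fin N) (Fin N) K)) (d : K)
    (hΨ : ∀ U : Matrix (Fin N) (Fin N) K, IsIntMatrix U → IsIntMatrix (d⁻¹ • (U - 1)) → ∀ A ∈ T, U * A ∈ T → Ψ (U * A) = Ψ A)
    (A : GL (Fin N) K) (B : Matrix (Fin N) (Fin N) K) (hAT : (A : Matrix (Fin N) (Fin N) K) ∈ T) (hBT : B ∈ T)
    (hAi : IsIntMatrix ((A⁻¹ : GL (Fin N) K) : Matrix (Fin N) (Fin N) K)) (hB : IsIntMatrix B)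
    (hAB : IsIntMatrix (d⁻¹ • ((A : Matrix (Fin N) (Fin N) K) - B))) : Ψ (A : Matrix (Fin N) (Fin N) K) = Ψ B := by
  have hBA : B = B * ((A⁻¹ : GL (Fin N) K) : Matrix (Fin N) (Fin N) K) * (A : Matrix (Fin N) (Fin N) K) := by
    rw [Matrix.mul_assoc, ← Units.val_mul, inv_mul_cancel, Units.val_one, Matrix.mul_one]
  have hU1 : B * ((A⁻¹ : GL (Fin N) K) : Matrix (Fin N) (Fin N) K) - 1 = (B - (A : Matrix (Fin N) (Fin N) K)) * ((A⁻¹ : GL (Fin N) K) : Matrix (Fin N) (Fin N) K) := by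
    rw [Matrix.sub_mul, ← Units.val_mul, mul_inv_cancel, Units.val_one]
  have hneg : IsIntMatrix (d⁻¹ • (B - (A : Matrix (Fin N) (Fin N) K))) := by
    have e : d⁻¹ • (B - (A : Matrix (Fin N) (Fin N) K)) = -(d⁻¹ • ((A : Matrix (Fin N) (Fin N) K) - B)) := by rw [← smul_neg, neg_sub]
    rw [e]
    exact fun i j => by rw [Matrix.neg_apply, Valuation.map_neg]; exact hAB i j
  have hBT' : B * ((A⁻¹ : GL (Fin N) K) : Matrix (Fin N) (Fin N) K) * (A : Matrix (Fin N) (Fin N) K) ∈ T := hBA ▸ hBT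
  rw [hBA, eq_comm]
  refine hΨ _ (isIntMatrix_mul hB hAi) ?_ _ hAT hBT'
  rw [hU1, ← Matrix.smul_mul]
  exact isIntMatrix_mul hneg hAi

/-- **VALUES ON FIXED VERTICES AGREE**: for `q(u) = γ^{(c)}` and any basis `g`, `Ψ(g⁻¹γg) = (Ψ ∘ r)(g⁻¹ug)`; together with ★ `setOf_levelFixed_vertex_eq_setOf_fixed` (the interior
level-`c` fixed vertices of `γ` ARE the `u`-fixed vertices) and §5 `levelClass_relabel` this is the T4′ induction step `(γ, level j+1) ↦ (u, level j)` for every class datum `Ψ`.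
[cite: Kottwitz1986, §3] [cite: Rogawski1990, §4.9 Prop. 4.9.1 (a) p. 55] -/
theorem apply_units_conj_eq_of_aeval_eq {β : Type*} (Ψ : Matrix (Fin N) (Fin N) K → β) {c : 𝒪[K]} (hc : (c : K) ≠ 0) (γ u g : GL (Fin N) K) (q : 𝒪[K][X])
    (hq : aeval (u : Matrix (Fin N) (Fin N) K) q = 1 + (c : K)⁻¹ • ((γ : Matrix (Fin N) (Fin N) K) - 1)) :
    Ψ ((g⁻¹ * γ * g : GL (Fin N) K) : Matrix (Fin N) (Fin N) K) = Ψ (aeval ((g⁻¹ * u * g : GL (Fin N) K) : Matrix (Fin N) (Fin N) K) (1 + C c * (q - 1))) := by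
  rw [units_conj_eq_aeval_relabel hc γ u g q hq]

/-! ## §6 The count form: sums over the interior level-`c` fixed vertices of `γ` are sums over the `u`-fixed vertices -/

/-- **COUNT FORM of the induction step** (A-68 (b) ∕ A-69 (iii)): for ANY summand `F` and every vertex type `d`,
`∑ᶠ_{M : γ·M = M, (γ−1)·M ⊆ c·M} F M = ∑ᶠ_{M : u·M = M} F M` — the two index sets coincide (★ `setOf_levelFixed_vertex_eq_setOf_fixed`); the relabelling enters only through
the VALUES, `F M = Ψ(g_M⁻¹ γ g_M) = (Ψ ∘ r)(g_M⁻¹ u g_M)` (§5 `apply_units_conj_eq_of_aeval_eq`). [cite: Kottwitz1986, §3] [cite: Rogawski1990, §4.9 Prop. 4.9.1 (a) p. 55] -/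
theorem finsum_mem_levelFixed_vertex_eq_finsum_mem_fixed {β : Type*} [AddCommMonoid β] (σ : K →+* K) (ϖ : K) (H : Matrix (Fin N) (Fin N) K) (d : ℕ)
    {c : K} (hc : c ≠ 0) (hc1 : Valued.v c < 1) (γ u : GL (Fin N) K)
    (hu : (u : Matrix (Fin N) (Fin N) K) ∈ Algebra.adjoin 𝒪[K] ({1 + c⁻¹ • ((γ : Matrix (Fin N) (Fin N) K) - 1)} : Set (Matrix (Fin N) (Fin N) K)))
    (hu' : ((u⁻¹ : GL (Fin N) K) : Matrix (Fin N) (Fin N) K) ∈ Algebra.adjoin 𝒪[K] ({1 + c⁻¹ • ((γ : Matrix (Fin N) (Fin N) K) - 1)} : Set (Matrix (Fin N) (Fin N) K)))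
    (hX : (1 + c⁻¹ • ((γ : Matrix (Fin N) (Fin N) K) - 1)) ∈ Algebra.adjoin 𝒪[K] ({(u : Matrix (Fin N) (Fin N) K)} : Set (Matrix (Fin N) (Fin N) K)))
    (F : Submodule 𝒪[K] (Fin N → K) → β) :
    ∑ᶠ M ∈ {M : Submodule 𝒪[K] (Fin N → K) | IsVertexLattice σ ϖ H d M ∧ mapGL γ M = M ∧
        M.map ((Matrix.toLin' ((γ : Matrix (Fin N) (Fin N) K) - 1)).restrictScalars 𝒪[K]) ≤ scaleLattice c M}, F M =
      ∑ᶠ M ∈ {M : Submodule 𝒪[K] (Fin N → K) | IsVertexLattice σ ϖ H d M ∧ mapGL u M = M}, F M := by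
  rw [setOf_levelFixed_vertex_eq_setOf_fixed σ ϖ H d hc hc1 γ u hu hu' hX]

end Literature.NumberTheory.Automorphic.UnitaryLatticeTree

end
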